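import Mathlib
import HarnessLib
import HarnessLib.Audit
import Summits.CriticalPhenomena.Statement

/-!
Route: PercFiniteBoxLRO

It suffices to show X_D [Cerf's missing estimate: finite-box long-range order at LINEAR scale from
θ(p) > 0 alone]:
for every p with θ(p) > 0 there are ρ > 0 and K ∈ ℕ such that for all n ≥ 1 and all x, y ∈ Λ(n) =
[−n,n]³,
   P_p( x ↔ y by an open path inside Λ(Kn) ) ≥ ρ,
together with the renormalisation step R: linear-scale LRO at parameter p ⇒ percolation at some p' <
p.
Cerf2015 (arXiv:1306.3105), Thm 1.3, proves X_D with Λ(Kn) replaced by Λ(n^16) in d = 3 (site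
percolation), 'without using
the slab technology', and states (p.5): 'it would be enough to have the above estimate within a box
of side length
proportional to n' for the renormalisation argument [Grimmett1999 §7.4] to yield θ(p_c) = 0.
Assembly: if θ(p_c) > 0 then X_D gives LRO at p_c, R gives p' < p_c with θ(p') > 0, contradicting θ
= 0 below p_c
(Literature.Probability.Percolation.theta_eq_zero_of_lt_criticalProb_holds). So X_D → R →
PercolationContinuityZ3.

Lean (X_D): ∀ p : unitInterval, 0 < Literature.Probability.Percolation.theta
(Literature.Probability.LatticeModels.zdGraph 3) 0 p → ∃ ρ : ℝ, 0 < ρ ∧ ∃ K : ℕ, ∀ n : ℕ, 1 ≤ n → ∀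
x ∈ Literature.Probability.LatticeModels.box 3 n, ∀ y ∈ Literature.Probability.LatticeModels.box 3
n, ρ ≤ (Literature.Probability.Percolation.bondPercolation
(Literature.Probability.LatticeModels.zdGraph 3) p).real
(Literature.Probability.Percolation.openConnIn ↑(Literature.Probability.LatticeModels.box 3 (K * n))
x y)

Rationale: WHY THIS LINE. The only quantitative information available AT p_c in d = 3 that does not presuppose
θ(p_c) = 0 comes from the
Aizenman–Kesten–Newman uniqueness proof (AizenmanKestenNewmanCMP1987; Gandolfi–Grimmett–Russo),
which — unlike Burton–Keane —
is quantitative: it yields the two-arms bound P_{p_c}(two-arms(0,n)) ≤ κ ln n/√n in every d.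
Cerf2015 (Ann. Probab. 43,
arXiv:1306.3105) sharpened this (Thm 1.1: exponent ≥ 12/23 in d = 3; Thm 1.2: two distinct clusters
from Λ(n) to ∂Λ(n^α)
have vanishing probability for large α) and, injecting θ(p) > 0, derived finite-box long-range order
at polynomial scale
Λ(n^16) (Thm 1.3) with NO slab/sprinkling input; VandenbergVanengelenburg2022
(doi:10.1214/21-aihp1153) bound the two-arms
exponent from the other side. The route is Cerf's programme made explicit: push the box from n^16 to
Kn (X_D), then run
the static renormalisation (R). Area imported: quantitative uniqueness / arm-exponent inequalities
(a different toolbox from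
the Grimmett–Marstrand dynamic renormalisation behind PercHalfSpace and from the two-point analysis
of PercTwoPointDecay).

RANKED CRUXES.
 r2 LinearScaleLROOfTheta = X_D (rank 2; Cerf's 'missing ingredient').
 r3 RenormaliseFromLinearLRO = R (rank 3): ∀ p, LRO_lin(p) → ∃ p' < p, θ(p') > 0. In the real world
LRO_lin(p_c) fails
    (τ_{p_c} → 0), so R is true, but a PROOF must be a block construction from connection
probabilities ≥ ρ (not ≥ 1 − ε) at
    all linear scales plus continuity in p of finitely many box events; the boosting from ρ to 1 − ε
without sprinkling is
    where refuters should look first (Cerf asserts sufficiency, Grimmett1999 §7.4 does it only with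
sprinkling).
 r4 PolyScaleLROOfTheta (rank 4): X_D with Λ(⌈n^α⌉) for EVERY α > 1 (Cerf: α = 16; any α < 16 is
publishable progress and
    the natural output of a better two-arms exponent, cf. Cerf2015 Thm 1.2 ↔ 1.3).
 r5 CritBoxTwoArmsDecay (rank 5): at p_c, P(two distinct open clusters of Λ(m), m = ⌈n^α⌉, both meet
Λ(n) and ∂Λ(m)) → 0 for
    every α > 1 (Cerf2015 Thm 1.2 gives α ≥ 43-ish in d = 3); the unconditional critical input
feeding r4.
 support (rank 9): Cerf2015BoxLRO16 — Cerf's Thm 1.3 transcribed to BOND percolation on ℤ³ (the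
paper treats site
    percolation; the AKN/GGR argument is model-independent — grounder to confirm), wanted as a
Literature fact.
 Assembly (rank 1): X_D → R → PercolationContinuityZ3.

KILL CRITERIA. ¬X_D at some p > p_c is impossible (supercritical LRO, Grimmett1999 §7); ¬X_D at p =
p_c is equivalent to
θ(p_c) > 0 ∧ ¬LRO_lin(p_c) — not a refutation of the conjunct but closes the route. The decisive
early test is r3: if a
refuter shows that block renormalisation from ρ-LRO provably needs sprinkling (e.g. a
dependent-percolation counterexample
with ρ-LRO at all scales but no percolation below), pivot r3 to 'LRO_lin(p) ∧ θ(p) > 0 → local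
uniqueness → …' or close.

NOT DECOMPOSED: the block event and the Liggett–Schonmann–Stacey domination step inside R; the
exponent bookkeeping linking
r5 → r4 (Cerf2015 §§6–7); site/bond transcription.

Novelty: NOVELTY (searched 2026-08-14 before claiming: `lit citing arxiv:1306.3105` (27 citing works, all
post-2015 ones screened), `lit related arxiv:1306.3105`, `lit frontier CriticalPhenomena --since
2018`, `lit search` / `lit search --hybrid` for "finite size criterion … without sprinkling / local
uniqueness", "two-arms exponent critical percolation Z^d", `lit galaxy search "two-arms exponent" |
"theta(p_c) = 0" --star pdf`, the barrier catalogue Literature/Barriers/CriticalPhenomena/*, `lean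
search 'Cerf2015' --decl`).
Nearest prior art and what each already contains:
(1) Cerf2015 (arXiv:1306.3105), Thm 1.3 and p.4: the thesis X_D is Cerf's own stated 'missing
ingredient' verbatim ("it would be enough to have the above estimate within a box of side length
proportional to n") and R is the sufficiency he asserts via [GR] = Grimmett1999 §7.4 and [PI] =
Pisztora 1996; Thm 1.3 itself (site percolation, box Λ(n^16) in d = 3) is now sorry-free in the tree
(Literature.Probability.Percolation.Cerf2015_thm_1_3_holds, Cerf2015_thm_1_3_three_holds).
(2) VandenbergVanengelenburg2022 (arXiv:2009.13337): Lemma 6 is a same-p, DOWNWARD, sprinkling-free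
block argument at p_c (LSS domination of the finite-dependent field of 'good' blocks + continuity of
p ↦ P_p(local event)) of exactly the kind R needs, but with input 'local uniqueness A_2(4n,4Mn)
fails w.p. < ε and easy-direction crossings w.h.p.'; Prop. 2 shows P_{p_c}(A_2(n_i, M n_i)) ≥ δ
unconditionally along a scale sequence; Thm 1 caps the tw  [refs: 1306.3105, 2009.13337, 2401.12397, 1902.03207, 1912.10964, arxiv:1306.3105, Cerf2015, Grimmett1999, VandenbergVanengelenburg2022, KozmaNitzan2024, DuminilcopinKozmaTassion2020, VandenbergDon2020]

Barriers (technique_class: static-renormalisation block-argument two-arms-exponent AKN): technique_class: static-renormalisation block-argument two-arms-exponent AKN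
- Literature.Barriers.CriticalPhenomena.SprinklingRenormalisation — APPLIES, squarely, to R
(RenormaliseFromLinearLRO): the Grimmett–Marstrand / static renormalisation certifies percolation
only at p + η ("it is vital … that η be assumed strictly positive", Grimmett1999 §7.3 p.162; Thm
(7.61)'s input is P → 1 of a uniqueness-type block event under p > p_c). Partial evasion only: the
downward step R needs is the LSS-domination + polynomial-continuity argument of
VandenbergVanengelenburg2022 Lemma 6, which applies FKG to no mixed information and therefore needs
no sprinkling — but only once local uniqueness at linear scale holds with high probability;
obtaining THAT from ρ-LRO (ρ < 1) at the same p is not evaded by anything in print (it is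
KozmaNitzan2024's 'inequality that needs to be justified'). The bet: uniform LRO at ALL linear
scales plus AKN/GGR quantitative uniqueness boosts ρ to 1 − ε without moving p. Kill signal: a proof
that any same-p boosting of ρ-connectivity to local uniqueness needs a monotone (sprinkled)
coupling, or a direct proof that LRO_lin(p) is compatible with P_p(A_2(n, Mn)) ≥ δ at all scales in
some finite-range FKG model on ℤ³.
- Literature.Barriers.CriticalPhenomena.RandomClusterFirstOrder — APPLIES to R: for q > Q(3) the
wired random-cluster measure has θ¹(p_c(q), q) > 0 (Grimmett2006 Thm (7.33)(b)), so at p_c(q)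
finite-box long-range order coexists with absence of percolat

Novelty grade: variant — ROUTE REVIEW (refuter rreview1, rev-3 file, 2026-08-15; details in today's check-notes on 0855–0860). VERDICT keep open: 0 blocked, 0 refuted, 6/6 elaborate (`closes` + SITE fact Cerf2015_thm_1_3_three_holds axiom-clean); not a recombination of closed routes (CCDGraph/DustSandwich/DislocationCovers/ (refuter refuter-rreview1-CriticalPhenomena-PercFiniteBo-5855308b-0, 2026-08-15T18:27:56Z; prior: ["arxiv:1306.3105", "arxiv:2009.13337", "arxiv:2401.12397", "arxiv:1902.03207", "arxiv:2008.11197", "Grimmett1999", "Literature.Barriers.CriticalPhenomena.SprinklingRenormalisation"])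

sub-problem: PercolationContinuityZ3 · status: open · opened planner-plan-CriticalPhenomena-PercolationContinuityZ3-0 2026-08-13T19:15:56Z · rev 3 · ledger route-CriticalPhenomena-PercFiniteBoxLRO
GENERATED by the gate from the ledger (D-0016/17). Provers cite these decls: `theorem foo : Summit.CriticalPhenomena.PercolationContinuityZ3.Theses.PercFiniteBoxLRO.<Decl> := …` in Summits/CriticalPhenomena/PercolationContinuityZ3/Theorems/<Name>.lean.
-/

namespace Summit.CriticalPhenomena.PercolationContinuityZ3.Theses.PercFiniteBoxLRO

open scoped BigOperators Topology Manifold Classical MeasureTheory ProbabilityTheory Matrix InnerProductSpace ComplexConjugate ContinuousMap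
open Filter Set Function TopologicalSpace MeasureTheory

attribute [summit_statement] _root_.PercolationContinuityZ3

/-- item stmt-CriticalPhenomena-0855 · crux · rank 2 · closed · proved by Summit.CriticalPhenomena.PercolationContinuityZ3.Theorems.PercFiniteBoxLROLinearScaleLROOfTheta.linearScaleLROOfTheta_proof @ df0ac2543c11 (prover) · by planner
why it might fail: Live only at a percolating p_c (p>p_c: Grimmett–Marstrand, heavy, not in tree). There τ≥θ² by FKG+uniqueness but nothing confines paths to Λ(Kn): at p_c two distinct clusters cross linear annuli w.p.≥δ on a scale sequence (vdBvE2022 Prop 2); Cerf's counting confines only to Λ(n^{(3d−1)/γ}), γ=2arm.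
sources: Cerf2015 Thm 1.3 and p.4 'missing ingredient' (arXiv:1306.3105), VandenbergVanengelenburg2022 Prop 2, Lemma 4 (arXiv:2009.13337), VandenbergDon2020 Cor 1.2 (arXiv:1912.10964): linear-scale connections at p_c only ≥ c n^{-d²}, Grimmett1999 Thm 7.2, §7.3 p.162, §7.4, Literature.Probability.Percolation.Cerf2015_thm_1_3_three_holds (site n^16 version, proved in tree)
[crux] r2 = X_D (Cerf2015 arXiv:1306.3105 p.5, "the missing ingredient"): for bond percolation on
Z^3, θ(p) > 0 alone implies finite-box long-range order at linear scale: ∃ ρ > 0, K with P_p(x ↔ y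
inside Λ(Kn)) ≥ ρ for all n ≥ 1 and x, y ∈ Λ(n) = box 3 n. Cerf2015 Thm 1.3 has Λ(n^16) instead of
Λ(Kn) (d = 3, site percolation, no slab technology). For p > p_c it is classical (Grimmett1999 §7);
the live case is a hypothetical percolating p_c. -/
@[route_item "route-CriticalPhenomena-PercFiniteBoxLRO"]
def LinearScaleLROOfTheta : Prop :=
  ∀ p : unitInterval, 0 < Literature.Probability.Percolation.theta (Literature.Probability.LatticeModels.zdGraph 3) 0 p → ∃ ρ : ℝ, 0 < ρ ∧ ∃ K : ℕ, ∀ n : ℕ, 1 ≤ n → ∀ x ∈ Literature.Probability.LatticeModels.box 3 n, ∀ y ∈ Literature.Probability.LatticeModels.box 3 n, ρ ≤ (Literature.Probability.Percolation.bondPercolation (Literature.Probability.LatticeModels.zdGraph 3) p).real (Literature.Probability.Percolation.openConnIn ↑(Literature.Probability.LatticeModels.box 3 (K * n)) x y)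

/-- item stmt-CriticalPhenomena-0857 · crux · rank 3 · closed · proved by Summit.CriticalPhenomena.PercolationContinuityZ3.Theorems.PercFiniteBoxLRORenormaliseFromLinearLRO.renormaliseFromLinearLRO_proof @ 9027a12a25f1 (prover) · by planner
why it might fail: As typed R ⇔ ¬LRO_lin(p_c) (p>p_c trivial, p<p_c vacuous): false iff ℤ³ has linear box LRO at p_c, as 1st-order analogues do (wired RC q>Q; AN 1/r² on ℤ). Same-p downward LSS step is in print (vdBvE2022 Lem 6) but needs local uniqueness whp—false at p_c on a scale seq (Prop 2); no ρ→uniqueness boost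
sources: VandenbergVanengelenburg2022 Lemma 6 and Prop 2 (arXiv:2009.13337), KozmaNitzan2024 §1 approach (1) and Thm 6 (arXiv:2401.12397): the same-p block step needs a conjectured inequality, DuminilcopinKozmaTassion2020 §1.1 Examples 1–4 (arXiv:1902.03207), Grimmett1999 §7.3 p.162 and §7.4 Thms 7.61/7.65, Literature.Barriers.CriticalPhenomena.SprinklingRenormalisation, Literature.Barriers.CriticalPhenomena.RandomClusterFirstOrder (Grimmett2006 Thm 7.33(b))
[crux] r3 = R (static renormalisation from linear-scale LRO, no sprinkling): for every p, if ∃ ρ>0,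
K with P_p(x ↔ y in Λ(Kn)) ≥ ρ for all n ≥ 1, x, y ∈ Λ(n), then θ(p′) > 0 for some p′ < p. Cerf2015
p.5 asserts this suffices via the renormalisation of Grimmett1999 §7.4 [4] and [12]; the proof must
boost ρ to 1 − ε_LSS by independent trials and pass to p′ < p by continuity of finitely many
box-event polynomials. TRUE in the real world (LRO_lin(p_c) fails when θ(p_c) = 0); refuters: test
whether ρ-LRO without uniqueness input can be renormalised at all. -/
@[route_item "route-CriticalPhenomena-PercFiniteBoxLRO"]
def RenormaliseFromLinearLRO : Prop :=
  ∀ p : unitInterval, (∃ ρ : ℝ, 0 < ρ ∧ ∃ K : ℕ, ∀ n : ℕ, 1 ≤ n → ∀ x ∈ Literature.Probability.LatticeModels.box 3 n, ∀ y ∈ Literature.Probability.LatticeModels.box 3 n, ρ ≤ (Literature.Probability.Percolation.bondPercolation (Literature.Probability.LatticeModels.zdGraph 3) p).real (Literature.Probability.Percolation.openConnIn ↑(Literature.Probability.LatticeModels.box 3 (K * n)) x y)) → ∃ p' : unitInterval, p' < p ∧ 0 < Literature.Probability.Percolation.theta (Literature.Probability.LatticeModels.zdGraph 3) 0 p'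

/-- item stmt-CriticalPhenomena-0858 · crux · rank 4 · closed · proved by Summit.CriticalPhenomena.PercolationContinuityZ3.Theorems.PercFiniteBoxLROPolyScaleLROOfTheta.polyScaleLROOfTheta_proof @ 0cc6ddf447bd (prover) · by planner
why it might fail: Monotone in α: it is its α→1⁺ tail ≈ X_D. Cerf's threshold α>46/3 (site) is α>(3d−1)/γ, so α<8 needs two-arms exponent γ>1 (proved 12/23) and α→1 needs γ≥8 > mean-field 4: the r5→r4 exponent engine stalls far from 1; at a percolating p_c the statement may simply be false. Bond version unpublished.
sources: Cerf2015 Thms 1.1–1.3 and §10 (arXiv:1306.3105), Literature.Probability.Percolation.Cerf2015_thm_1_3_holds (site, α>(4d²+5d−5)(3d−1)/(2d²+3d−3)), VandenbergVanengelenburg2022 Thm 1: two-arms exponent ≤ d²+4d−2; intro: exponent 4 in high d (arXiv:2009.13337), VandenbergDon2020 p.3: only a 'small improvement' of Cerf's exponent (arXiv:1912.10964)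
[crux] r4: X_D at every polynomial scale: ∀ α > 1, ∀ p with θ(p) > 0, ∃ ρ > 0: P_p(x ↔ y inside
Λ(⌈n^α⌉)) ≥ ρ for all n ≥ 1, x, y ∈ Λ(n). Cerf2015 Thm 1.3: α = 16 (d = 3, from α >
(4d²+5d−5)(3d−1)/(2d²+3d−3)); each improvement of the box two-arms exponent (r5) lowers α (Cerf2015
§§6–7). Intermediate milestone between the Literature fact (α = 16) and X_D (α = 1 with a constant
K). -/
@[route_item "route-CriticalPhenomena-PercFiniteBoxLRO"]
def PolyScaleLROOfTheta : Prop :=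
  ∀ α : ℝ, 1 < α → ∀ p : unitInterval, 0 < Literature.Probability.Percolation.theta (Literature.Probability.LatticeModels.zdGraph 3) 0 p → ∃ ρ : ℝ, 0 < ρ ∧ ∀ n : ℕ, 1 ≤ n → ∀ x ∈ Literature.Probability.LatticeModels.box 3 n, ∀ y ∈ Literature.Probability.LatticeModels.box 3 n, ρ ≤ (Literature.Probability.Percolation.bondPercolation (Literature.Probability.LatticeModels.zdGraph 3) p).real (Literature.Probability.Percolation.openConnIn ↑(Literature.Probability.LatticeModels.box 3 ⌈(n : ℝ) ^ α⌉₊) x y)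

/-- item stmt-CriticalPhenomena-0859 · crux · rank 5 · open · by planner
why it might fail: Print: α>42.17 only (site p_c, Cerf Thm 1.2), dimension-uniform AKN counting. '∀α>1' is dimension-sensitive: for d>6 critical boxes carry ≍L^{d−6} spanning clusters (Aizenman1997), analogue expected false for α<(d−4)/2, so d=3 needs a d<6 input nobody has; at α=1 it IS false at p_c (vdBvE Prop 2).
sources: Cerf2015 Thm 1.2, event p.12 (arXiv:1306.3105), VandenbergVanengelenburg2022 Prop 2 (arXiv:2009.13337), Aizenman1997 Thm 4 via Literature.Barriers.CriticalPhenomena.SpanningClustersAboveSix, DuminilcopinKozmaTassion2020 §1.1: 'in high dimensions Λ_n hosts many disjoint clusters at p_c' (arXiv:1902.03207)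
[crux] r5 (critical two-arms for boxes, all polynomial aspect ratios): at p = p_c(Z^3), for every α
> 1, the probability that the configuration restricted to Λ(m), m = ⌈n^α⌉, contains two DISTINCT
open clusters each meeting both Λ(n) and the inner boundary of Λ(m) tends to 0 as n → ∞ (encoded: x,
x′ ∈ box 3 n, y, y′ ∈ innerBoundary, x ↔ y and x′ ↔ y′ in Λ(m) but not x ↔ x′ in Λ(m)). Cerf2015 Thm
1.2 proves it for α > (2d²+2d−2)(4d²+5d−5)/(2d²+3d−3) (= 43.6 for d = 3) via the quantitative AKN
argument; VandenbergVanengelenburg2022 for upper bounds on the exponent. Unconditional critical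
input for r4. -/
@[route_item "route-CriticalPhenomena-PercFiniteBoxLRO"]
def CritBoxTwoArmsDecay : Prop :=
  ∀ α : ℝ, 1 < α → Filter.Tendsto (fun n : ℕ => (Literature.Probability.Percolation.bondPercolation (Literature.Probability.LatticeModels.zdGraph 3) (Literature.Probability.Percolation.criticalProbI 3)).real {ω | ∃ x ∈ Literature.Probability.LatticeModels.box 3 n, ∃ x' ∈ Literature.Probability.LatticeModels.box 3 n, ∃ y ∈ Literature.Probability.LatticeModels.innerBoundary (Literature.Probability.LatticeModels.zdGraph 3) (Literature.Probability.LatticeModels.box 3 ⌈(n : ℝ) ^ α⌉₊), ∃ y' ∈ Literature.Probability.LatticeModels.innerBoundary (Literature.Probability.LatticeModels.zdGraph 3) (Literature.Probability.LatticeModels.box 3 ⌈(n : ℝ) ^ α⌉₊), ω ∈ Literature.Probability.Percolation.openConnIn ↑(Literature.Probability.LatticeModels.box 3 ⌈(n : ℝ) ^ α⌉₊) x y ∧ ω ∈ Literature.Probability.Percolation.openConnIn ↑(Literature.Probability.LatticeModels.box 3 ⌈(n : ℝ) ^ α⌉₊) x' y' ∧ ω ∉ Literature.Probability.Percolation.openConnIn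 ↑(Literature.Probability.LatticeModels.box 3 ⌈(n : ℝ) ^ α⌉₊) x x'}) Filter.atTop (nhds 0)

/-- item stmt-CriticalPhenomena-0860 · support · rank 9 · closed · proved by Summit.CriticalPhenomena.PercolationContinuityZ3.Theorems.cerf2015BoxLRO16_proof @ 93d0593edb95 (prover) · by planner
sources: Literature.Probability.Percolation.Cerf2015_thm_1_3_three_holds (CerfThm13Proofs.lean:83, sorry-free site version), Cerf2015 Thm 1.3 case d=3 (arXiv:1306.3105)
[support] Cerf2015 (Ann. Probab. 43 (2015) 2458–2480, arXiv:1306.3105) Thm 1.3, case d = 3,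
transcribed to BOND percolation on Z^3: θ(p) > 0 ⇒ ∃ ρ > 0, ∀ n ≥ 1, ∀ x, y ∈ Λ(n), P_p(x ↔ y in
Λ(n^16)) ≥ ρ. The paper is written for site percolation; the argument (Gandolfi–Grimmett–Russo form
of AKN uniqueness + θ > 0) is model-independent — grounder to confirm and file as a Literature named
fact (h : Cerf2015_boxLRO). -/
@[route_item "route-CriticalPhenomena-PercFiniteBoxLRO"]
def Cerf2015BoxLRO16 : Prop :=
  ∀ p : unitInterval, 0 < Literature.Probability.Percolation.theta (Literature.Probability.LatticeModels.zdGraph 3) 0 p → ∃ ρ : ℝ, 0 < ρ ∧ ∀ n : ℕ, 1 ≤ n → ∀ x ∈ Literature.Probability.LatticeModels.box 3 n, ∀ y ∈ Literature.Probability.LatticeModels.box 3 n, ρ ≤ (Literature.Probability.Percolation.bondPercolation (Literature.Probability.LatticeModels.zdGraph 3) p).real (Literature.Probability.Percolation.openConnIn ↑(Literature.Probability.LatticeModels.box 3 (n ^ 16)) x y)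

/-- item stmt-CriticalPhenomena-0856 · assembly · rank 1 · closed · proved by Summit.CriticalPhenomena.PercolationContinuityZ3.Theorems.percFiniteBoxLRO_assembly_proof @ 8bd62129e322 (prover) · by planner
[assembly] X_D → R → PercolationContinuityZ3. Proof: if θ(p_c) ≠ 0 then θ(p_c) > 0; X_D at
criticalProbI 3 gives linear LRO; R gives p′ < criticalProbI 3 with θ(p′) > 0; but (p′ : ℝ) <
criticalProb (zdGraph 3) 0 so θ(p′) = 0 by
Literature.Probability.Percolation.theta_eq_zero_of_lt_criticalProb_holds. Checked to elaborate and
close in 6 lines in the planner sketch. -/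
@[route_item "route-CriticalPhenomena-PercFiniteBoxLRO"]
def Assembly : Prop :=
  (∀ p : unitInterval, 0 < Literature.Probability.Percolation.theta (Literature.Probability.LatticeModels.zdGraph 3) 0 p → ∃ ρ : ℝ, 0 < ρ ∧ ∃ K : ℕ, ∀ n : ℕ, 1 ≤ n → ∀ x ∈ Literature.Probability.LatticeModels.box 3 n, ∀ y ∈ Literature.Probability.LatticeModels.box 3 n, ρ ≤ (Literature.Probability.Percolation.bondPercolation (Literature.Probability.LatticeModels.zdGraph 3) p).real (Literature.Probability.Percolation.openConnIn ↑(Literature.Probability.LatticeModels.box 3 (K * n)) x y)) → (∀ p : unitInterval, (∃ ρ : ℝ, 0 < ρ ∧ ∃ K : ℕ, ∀ n : ℕ, 1 ≤ n → ∀ x ∈ Literature.Probability.LatticeModels.box 3 n, ∀ y ∈ Literature.Probability.LatticeModels.box 3 n, ρ ≤ (Literature.Probability.Percolation.bondPercolation (Literature.Probability.LatticeModels.zdGraph 3) p).real (Literature.Probability.Percolation.openConnIn ↑(Literature.Probability.LatticeModels.box 3 (K * n)) x y)) → ∃ p' : unitInterval, p' < p ∧ 0 < Literature.Probability.Percolation.theta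 (Literature.Probability.LatticeModels.zdGraph 3) 0 p') → PercolationContinuityZ3

/-! D-0027 §2.1 — DECIDING THEOREM (planner-authored via `route open/edit --closes-file`; by planner-rbadge-CriticalPhenomena-PercFiniteBox-5855308b-g4-0 2026-08-15T16:09:44Z):
its hypotheses are this route's items and its conclusion the sub-problem Statement (glue_lint), and it elaborates with this file. -/

@[closes "route-CriticalPhenomena-PercFiniteBoxLRO"] theorem closes : LinearScaleLROOfTheta → RenormaliseFromLinearLRO → PolyScaleLROOfTheta → CritBoxTwoArmsDecay → Cerf2015BoxLRO16 → Assembly → _root_.PercolationContinuityZ3 := by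
  intro hX hR _hPoly _hTwoArms _hCerf _hAssembly
  -- θ(p_c) = 0 by contradiction: θ(p_c) > 0 ⟹ (X_D) linear-scale LRO at p_c ⟹ (R) θ(p') > 0 for some p' < p_c,
  -- contradicting θ ≡ 0 below p_c (Literature.Probability.Percolation.theta_eq_zero_of_lt_criticalProb_holds, PROVED).
  show Literature.Probability.Percolation.theta (Literature.Probability.LatticeModels.zdGraph 3) (0 : Literature.Probability.LatticeModels.Site 3) (Literature.Probability.Percolation.criticalProbI 3) = 0
  by_contra hne
  have hpos : 0 < Literature.Probability.Percolation.theta (Literature.Probability.LatticeModels.zdGraph 3) (0 : Literature.Probability.LatticeModels.Site 3) (Literature.Probability.Percolation.criticalProbI 3) :=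
    lt_of_le_of_ne MeasureTheory.measureReal_nonneg (Ne.symm hne)
  obtain ⟨p', hp'lt, hp'pos⟩ := hR (Literature.Probability.Percolation.criticalProbI 3) (hX (Literature.Probability.Percolation.criticalProbI 3) hpos)
  have hlt : ((p' : unitInterval) : ℝ) < Literature.Probability.Percolation.criticalProb (Literature.Probability.LatticeModels.zdGraph 3) (0 : Literature.Probability.LatticeModels.Site 3) :=
    hp'lt
  have h0 : Literature.Probability.Percolation.theta (Literature.Probability.LatticeModels.zdGraph 3) (0 : Literature.Probability.LatticeModels.Site 3) p' = 0 :=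
    Literature.Probability.Percolation.theta_eq_zero_of_lt_criticalProb_holds (Literature.Probability.LatticeModels.zdGraph 3) (0 : Literature.Probability.LatticeModels.Site 3) p' hlt
  exact absurd h0 (ne_of_gt hp'pos)

end Summit.CriticalPhenomena.PercolationContinuityZ3.Theses.PercFiniteBoxLRO
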